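import Mathlib
import Literature.Probability.LatticeModels.ThermodynamicLimit
import Literature.Probability.LatticeModels.SharpnessProofs
import Summits.CriticalPhenomena.Ising3DConformalLimit.Theorems.PrecisionLaplacianDirectCorrelationStableTailRieszGaussianAux
import HarnessLib

/-!
# Helpers (II) for stub `stub_levyContinuityTransfer` of line `diffusive-branch-is-nonsaturation`
(crux `PrecisionLaplacian.DirectCorrelationStableTail`, item stmt-CriticalPhenomena-4799)

**Gaussian averaging of the lattice symbol.**  Let `γ(η) = (2π)^{-3/2} e^{-|η|₂²/2}` be the standard
Gaussian density on `ℝ³ = Fin 3 → ℝ` (product Lebesgue measure) and `g(u) = 1 - e^{-|u|₂²/2}`.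

* `levyCT_gauss_cos_integral`, `levyCT_gauss_integral_one`, `levyCT_weight_eq_gauss_average`:
  `∫ γ(η) cos(η·u) dη = e^{-|u|₂²/2}` (from the landed Gaussian integral with phase
  `rieszG_gauss_integral_zero`), hence `g(u) = ∫ γ(η)(1 - cos(η·u)) dη`;
  `levyCT_gauss_moment_integrable`: `(1 + |η|₂²)γ(η)` is integrable.
* `levyCT_lattice_cos_transform` (registered helper sub-goal
  `stub_levyContinuityTransfer_auxLatticeCosTransform`): for `m ∈ ℓ¹(ℤ³)` and the weighted rescaled
  lattice measure `μ_R = ∑ₓ R^α m(x) g(x/R) δ_{x/R}`, its cosine transform is a Gaussian average of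
  second differences of the symbol `ψ_R(k) = R^α ∑_y m(y)(1 - cos(k·y/R))`:
  `∑ₓ R^α m(x) g(x/R) cos(ξ·x/R) = ∫ γ(η) ((ψ_R(ξ+η) + ψ_R(ξ-η))/2 - ψ_R(ξ)) dη`
  (Fubini for the absolutely convergent sum/integral, and
  `cos a (1 - cos b) = ((1 - cos(a+b)) + (1 - cos(a-b)))/2 - (1 - cos a)`);
  `levyCT_lattice_sin_transform`: the sine transform vanishes for even `m`.
* `levyCT_dominated`: dominated convergence for such Gaussian averages under the quadratic-growth
  domination `|ψₙ(k)| ≤ C₂(1 + |k|₂²)`.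

All statements are folklore (Lévy–Khintchine calculus, e.g. K. Sato, *Lévy Processes and Infinitely
Divisible Distributions* (1999), §8); no definitions are introduced.
-/

noncomputable section

namespace Summit.CriticalPhenomena.Ising3DConformalLimit.Cruxes.DirectCorrelationStableTail.DiffusiveBranchIsNonsaturation

open MeasureTheory Filter Topology
open scoped BigOperators
open Literature.Probability.LatticeModels

/-! ### The standard Gaussian density on `ℝ³` -/

/-- **Gaussian cosine transform on `ℝ³`.**
`∫ e^{-|η|₂²/2} cos(η·u) dη = (2π)^{3/2} e^{-|u|₂²/2}` (from the landed Gaussian integral with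
phase `rieszG_gauss_integral_zero`). [folklore] -/
theorem levyCT_gauss_cos_integral (u : Fin 3 → ℝ) :
    ∫ η : Fin 3 → ℝ, Real.exp (-(1 / 2 * ∑ i, η i ^ 2)) * Real.cos (∑ i, η i * u i) =
      (2 * Real.pi) ^ (3 / 2 : ℝ) * Real.exp (-(1 / 2 * ∑ i, u i ^ 2)) := by
  have h := rieszG_gauss_integral_zero (s := 1 / 4) (t := 1 / 4) (by norm_num) (by norm_num) u
  have hpt : ∀ η : Fin 3 → ℝ, Real.exp (-(1 / 4 * ∑ i, η i ^ 2)) *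
      (Real.exp (-(1 / 4 * ∑ i, η i ^ 2)) * Real.cos (∑ i, u i * η i)) =
      Real.exp (-(1 / 2 * ∑ i, η i ^ 2)) * Real.cos (∑ i, η i * u i) := by
    intro η
    rw [← mul_assoc, ← Real.exp_add]
    congr 1
    · congr 1
      ring
    · congr 1
      exact Finset.sum_congr rfl fun i _ => mul_comm _ _
  simp_rw [hpt] at h
  rw [h]
  congr 1
  · congr 1
    ring
  · congr 1
    ring

/-- The normalised Gaussian has total mass one:
`∫ (2π)^{-3/2} e^{-|η|₂²/2} dη = 1`. [folklore] -/
theorem levyCT_gauss_integral_one :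
    ∫ η : Fin 3 → ℝ, Real.exp (-(1 / 2 * ∑ i, η i ^ 2)) / (2 * Real.pi) ^ (3 / 2 : ℝ) = 1 := by
  have h := levyCT_gauss_cos_integral 0
  simp only [Pi.zero_apply, mul_zero, Finset.sum_const_zero, Real.cos_zero, mul_one,
    ne_eq, OfNat.ofNat_ne_zero, not_false_eq_true, zero_pow, neg_zero, Real.exp_zero] at h
  rw [integral_div, h, div_self]
  positivity

/-- Integrability of the Gaussian `e^{-|η|₂²/2}` and of its second moment density
`(1 + |η|₂²) e^{-|η|₂²/2}` on `ℝ³` (domination `s e^{-s/2} ≤ 4 e^{-s/4}`). [folklore] -/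
theorem levyCT_gauss_moment_integrable :
    Integrable (fun η : Fin 3 → ℝ =>
      (1 + ∑ i, η i ^ 2) * (Real.exp (-(1 / 2 * ∑ i, η i ^ 2)) / (2 * Real.pi) ^ (3 / 2 : ℝ))) := by
  have h2 := rieszG_integrable_gauss (b := 1 / 2) (by norm_num)
  have h4 := rieszG_integrable_gauss (b := 1 / 4) (by norm_num)
  refine ((h2.add (h4.const_mul 4)).div_const ((2 * Real.pi) ^ (3 / 2 : ℝ))).mono'
    (by fun_prop : Continuous fun η : Fin 3 → ℝ => (1 + ∑ i, η i ^ 2) *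
      (Real.exp (-(1 / 2 * ∑ i, η i ^ 2)) / (2 * Real.pi) ^ (3 / 2 : ℝ))).aestronglyMeasurable
    (ae_of_all _ fun η => ?_)
  have hS : 0 ≤ ∑ i, η i ^ 2 := Finset.sum_nonneg fun i _ => sq_nonneg _
  have hpi : 0 < (2 * Real.pi) ^ (3 / 2 : ℝ) := by positivity
  have hnn : 0 ≤ (1 + ∑ i, η i ^ 2) *
      (Real.exp (-(1 / 2 * ∑ i, η i ^ 2)) / (2 * Real.pi) ^ (3 / 2 : ℝ)) := by positivity
  rw [Real.norm_eq_abs, abs_of_nonneg hnn, Pi.add_apply, ← mul_div_assoc,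
    div_le_div_iff_of_pos_right hpi]
  -- `s e^{-s/2} ≤ 4 e^{-s/4}` from `s/4 ≤ e^{s/4}`
  have hkey : (∑ i, η i ^ 2) * Real.exp (-(1 / 2 * ∑ i, η i ^ 2)) ≤
      4 * Real.exp (-(1 / 4 * ∑ i, η i ^ 2)) := by
    have h1 : 1 / 4 * (∑ i, η i ^ 2) + 1 ≤ Real.exp (1 / 4 * ∑ i, η i ^ 2) := Real.add_one_le_exp _
    have h3 : Real.exp (-(1 / 2 * ∑ i, η i ^ 2)) =
        Real.exp (-(1 / 4 * ∑ i, η i ^ 2)) * Real.exp (-(1 / 4 * ∑ i, η i ^ 2)) := by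
      rw [← Real.exp_add]
      congr 1
      ring
    have h4 : Real.exp (1 / 4 * ∑ i, η i ^ 2) * Real.exp (-(1 / 4 * ∑ i, η i ^ 2)) = 1 := by
      rw [← Real.exp_add, add_neg_cancel, Real.exp_zero]
    have h5 := Real.exp_pos (-(1 / 4 * ∑ i, η i ^ 2))
    rw [h3, ← mul_assoc]
    apply mul_le_mul_of_nonneg_right _ h5.le
    nlinarith
  nlinarith [Real.exp_pos (-(1 / 2 * ∑ i, η i ^ 2))]

/-- **Gaussian averaging of the weight.**  With `γ` the standard Gaussian density on `ℝ³`,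
`1 - e^{-|u|₂²/2} = ∫ γ(η) (1 - cos(η·u)) dη`. [folklore] -/
theorem levyCT_weight_eq_gauss_average (u : Fin 3 → ℝ) :
    1 - Real.exp (-(1 / 2 * ∑ i, u i ^ 2)) =
      ∫ η : Fin 3 → ℝ, Real.exp (-(1 / 2 * ∑ i, η i ^ 2)) / (2 * Real.pi) ^ (3 / 2 : ℝ) *
        (1 - Real.cos (∑ i, η i * u i)) := by
  have hpi : 0 < (2 * Real.pi) ^ (3 / 2 : ℝ) := by positivity
  have hγ := rieszG_integrable_gauss (b := 1 / 2) (by norm_num)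
  have hγcos : Integrable (fun η : Fin 3 → ℝ =>
      Real.exp (-(1 / 2 * ∑ i, η i ^ 2)) / (2 * Real.pi) ^ (3 / 2 : ℝ) *
        Real.cos (∑ i, η i * u i)) := by
    refine (hγ.div_const _).mul_bdd (c := 1)
      (by fun_prop : Continuous fun η : Fin 3 → ℝ =>
        Real.cos (∑ i, η i * u i)).aestronglyMeasurable (ae_of_all _ fun η => ?_)
    simpa using Real.abs_cos_le_one _
  have hcos := levyCT_gauss_cos_integral u
  simp_rw [mul_sub, mul_one]
  rw [integral_sub (hγ.div_const _) hγcos, levyCT_gauss_integral_one]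
  congr 1
  have e : (fun η : Fin 3 → ℝ => Real.exp (-(1 / 2 * ∑ i, η i ^ 2)) / (2 * Real.pi) ^ (3 / 2 : ℝ) *
      Real.cos (∑ i, η i * u i)) = fun η => (Real.exp (-(1 / 2 * ∑ i, η i ^ 2)) *
        Real.cos (∑ i, η i * u i)) / (2 * Real.pi) ^ (3 / 2 : ℝ) := by
    funext η
    ring
  rw [e, integral_div, hcos]
  field_simp


/-! ### The lattice measures: cosine and sine transforms as Gaussian averages of the symbol -/

/-- **Cosine transform of the weighted lattice measure as a Gaussian average of the symbol.**
For `m ∈ ℓ¹(ℤ³)`, scale `R` and the symbol `ψ(k) = R^α ∑_y m(y)(1 - cos(k·y/R))`,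
`∑ₓ R^α m(x) (1 - e^{-|x/R|₂²/2}) cos(ξ·x/R) = ∫ γ(η) ((ψ(ξ+η) + ψ(ξ-η))/2 - ψ(ξ)) dη`
(`γ` the standard Gaussian density; Fubini for the absolutely convergent sum/integral and
`cos a (1 - cos b) = ((1 - cos(a+b)) + (1 - cos(a-b)))/2 - (1 - cos a)`). [folklore] -/
theorem levyCT_lattice_cos_transform (m : Site 3 → ℝ) (hm : Summable m) (α : ℝ) (R : ℕ)
    (ψ : (Fin 3 → ℝ) → ℝ)
    (hψ : ∀ k, ψ k =
      (R : ℝ) ^ α * ∑' y : Site 3, m y * (1 - Real.cos (∑ i, k i * ((y i : ℝ) / R))))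
    (ξ : Fin 3 → ℝ) :
    ∑' x : Site 3, (R : ℝ) ^ α * m x * (1 - Real.exp (-(1 / 2 * ∑ i, ((x i : ℝ) / R) ^ 2))) *
        Real.cos (∑ j, ξ j * ((x j : ℝ) / R)) =
      ∫ η : Fin 3 → ℝ, Real.exp (-(1 / 2 * ∑ i, η i ^ 2)) / (2 * Real.pi) ^ (3 / 2 : ℝ) *
        ((ψ (ξ + η) + ψ (ξ - η)) / 2 - ψ ξ) := by
  set γ : (Fin 3 → ℝ) → ℝ :=
    fun η => Real.exp (-(1 / 2 * ∑ i, η i ^ 2)) / (2 * Real.pi) ^ (3 / 2 : ℝ) with hγ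
  have hγ0 : ∀ η, 0 ≤ γ η := fun η => by positivity
  have hγint : Integrable γ := (rieszG_integrable_gauss (b := 1 / 2) (by norm_num)).div_const _
  have hγ1 : ∫ η, γ η = 1 := levyCT_gauss_integral_one
  have hRα : 0 ≤ (R : ℝ) ^ α := Real.rpow_nonneg (Nat.cast_nonneg R) α
  -- the summand family `G x η`
  set G : Site 3 → (Fin 3 → ℝ) → ℝ := fun x η =>
    γ η * ((R : ℝ) ^ α * m x * Real.cos (∑ j, ξ j * ((x j : ℝ) / R)) *
      (1 - Real.cos (∑ i, η i * ((x i : ℝ) / R)))) with hG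
  -- Step 1: each summand is a Gaussian integral
  have h1 : ∀ x : Site 3,
      (R : ℝ) ^ α * m x * (1 - Real.exp (-(1 / 2 * ∑ i, ((x i : ℝ) / R) ^ 2))) *
        Real.cos (∑ j, ξ j * ((x j : ℝ) / R)) = ∫ η, G x η := by
    intro x
    have e := levyCT_weight_eq_gauss_average (fun j => (x j : ℝ) / R)
    beta_reduce at e
    rw [e, ← integral_const_mul, ← integral_mul_const]
    refine integral_congr_ae (ae_of_all _ fun η => ?_)
    simp only [hG]
    ring
  -- Step 2: absolute convergence, swap sum and integral
  have hGint : ∀ x, Integrable (G x) := by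
    intro x
    refine hγint.mul_bdd (c := (R : ℝ) ^ α * |m x| * 2)
      (by fun_prop : Continuous fun η : Fin 3 → ℝ => (R : ℝ) ^ α * m x *
        Real.cos (∑ j, ξ j * ((x j : ℝ) / R)) *
          (1 - Real.cos (∑ i, η i * ((x i : ℝ) / R)))).aestronglyMeasurable
      (ae_of_all _ fun η => ?_)
    rw [Real.norm_eq_abs, abs_mul, abs_mul, abs_mul, abs_of_nonneg hRα]
    have hc : |Real.cos (∑ j, ξ j * ((x j : ℝ) / R))| ≤ 1 := Real.abs_cos_le_one _
    have hd : |1 - Real.cos (∑ i, η i * ((x i : ℝ) / R))| ≤ 2 := by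
      rw [abs_le]
      constructor <;>
        linarith [Real.cos_le_one (∑ i, η i * ((x i : ℝ) / R)),
          Real.neg_one_le_cos (∑ i, η i * ((x i : ℝ) / R))]
    have h0 : 0 ≤ (R : ℝ) ^ α * |m x| := mul_nonneg hRα (abs_nonneg _)
    calc (R : ℝ) ^ α * |m x| * |Real.cos (∑ j, ξ j * ((x j : ℝ) / R))| *
          |1 - Real.cos (∑ i, η i * ((x i : ℝ) / R))|
        ≤ (R : ℝ) ^ α * |m x| * 1 * 2 :=
          mul_le_mul (mul_le_mul_of_nonneg_left hc h0) hd (abs_nonneg _) (by positivity)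
      _ = (R : ℝ) ^ α * |m x| * 2 := by ring
  have hGnorm : ∀ x, ∫ η, ‖G x η‖ ≤ 2 * (R : ℝ) ^ α * |m x| := by
    intro x
    have hb : ∀ η, ‖G x η‖ ≤ γ η * (2 * (R : ℝ) ^ α * |m x|) := by
      intro η
      simp only [hG]
      rw [Real.norm_eq_abs, abs_mul, abs_of_nonneg (hγ0 η)]
      refine mul_le_mul_of_nonneg_left ?_ (hγ0 η)
      rw [abs_mul, abs_mul, abs_mul, abs_of_nonneg hRα]
      have hc : |Real.cos (∑ j, ξ j * ((x j : ℝ) / R))| ≤ 1 := Real.abs_cos_le_one _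
      have hd : |1 - Real.cos (∑ i, η i * ((x i : ℝ) / R))| ≤ 2 := by
        rw [abs_le]
        constructor <;>
          linarith [Real.cos_le_one (∑ i, η i * ((x i : ℝ) / R)),
            Real.neg_one_le_cos (∑ i, η i * ((x i : ℝ) / R))]
      have h0 : 0 ≤ (R : ℝ) ^ α * |m x| := mul_nonneg hRα (abs_nonneg _)
      calc (R : ℝ) ^ α * |m x| * |Real.cos (∑ j, ξ j * ((x j : ℝ) / R))| *
            |1 - Real.cos (∑ i, η i * ((x i : ℝ) / R))|
          ≤ (R : ℝ) ^ α * |m x| * 1 * 2 :=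
            mul_le_mul (mul_le_mul_of_nonneg_left hc h0) hd (abs_nonneg _) (by positivity)
        _ = 2 * (R : ℝ) ^ α * |m x| := by ring
    calc ∫ η, ‖G x η‖ ≤ ∫ η, γ η * (2 * (R : ℝ) ^ α * |m x|) :=
          integral_mono (hGint x).norm (hγint.mul_const _) hb
      _ = 2 * (R : ℝ) ^ α * |m x| := by rw [integral_mul_const, hγ1, one_mul]
  have hsum : Summable fun x => ∫ η, ‖G x η‖ :=
    Summable.of_nonneg_of_le (fun x => integral_nonneg fun η => norm_nonneg _) hGnorm
      (hm.abs.mul_left (2 * (R : ℝ) ^ α))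
  rw [tsum_congr h1, integral_tsum_of_summable_integral_norm hGint hsum]
  -- Step 3: the sum under the integral, pointwise in `η`
  refine integral_congr_ae (ae_of_all _ fun η => ?_)
  simp only [hG]
  rw [tsum_mul_left]
  congr 1
  have htrig : ∀ a b : ℝ, Real.cos a * (1 - Real.cos b) =
      ((1 - Real.cos (a + b)) + (1 - Real.cos (a - b))) / 2 - (1 - Real.cos a) := by
    intro a b
    rw [Real.cos_add, Real.cos_sub]
    ring
  have hpt : ∀ x : Site 3,
      (R : ℝ) ^ α * m x * Real.cos (∑ j, ξ j * ((x j : ℝ) / R)) *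
        (1 - Real.cos (∑ i, η i * ((x i : ℝ) / R))) =
      ((R : ℝ) ^ α * (m x * (1 - Real.cos (∑ i, (ξ + η) i * ((x i : ℝ) / R)))) +
        (R : ℝ) ^ α * (m x * (1 - Real.cos (∑ i, (ξ - η) i * ((x i : ℝ) / R))))) / 2 -
        (R : ℝ) ^ α * (m x * (1 - Real.cos (∑ i, ξ i * ((x i : ℝ) / R)))) := by
    intro x
    simp only [Pi.add_apply, Pi.sub_apply, add_mul, sub_mul, Finset.sum_add_distrib,
      Finset.sum_sub_distrib]
    rw [show (R : ℝ) ^ α * m x * Real.cos (∑ j, ξ j * ((x j : ℝ) / R)) *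
        (1 - Real.cos (∑ i, η i * ((x i : ℝ) / R))) = (R : ℝ) ^ α * m x *
          (Real.cos (∑ j, ξ j * ((x j : ℝ) / R)) *
            (1 - Real.cos (∑ i, η i * ((x i : ℝ) / R)))) by ring, htrig]
    ring
  have hS : ∀ k : Fin 3 → ℝ, Summable fun x : Site 3 =>
      (R : ℝ) ^ α * (m x * (1 - Real.cos (∑ i, k i * ((x i : ℝ) / R)))) := by
    intro k
    refine (Summable.of_norm_bounded
      (f := fun x : Site 3 => m x * (1 - Real.cos (∑ i, k i * ((x i : ℝ) / R))))
      (hm.abs.mul_left 2) (fun x => ?_)).mul_left ((R : ℝ) ^ α)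
    rw [Real.norm_eq_abs, abs_mul]
    have hd : |1 - Real.cos (∑ i, k i * ((x i : ℝ) / R))| ≤ 2 := by
      rw [abs_le]
      constructor <;>
        linarith [Real.cos_le_one (∑ i, k i * ((x i : ℝ) / R)),
          Real.neg_one_le_cos (∑ i, k i * ((x i : ℝ) / R))]
    nlinarith [abs_nonneg (m x), abs_nonneg (1 - Real.cos (∑ i, k i * ((x i : ℝ) / R)))]
  simp_rw [hpt]
  rw [Summable.tsum_sub (((hS (ξ + η)).add (hS (ξ - η))).div_const 2) (hS ξ)]
  rw [tsum_div_const]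
  rw [Summable.tsum_add (hS (ξ + η)) (hS (ξ - η))]
  rw [tsum_mul_left, tsum_mul_left, tsum_mul_left]
  rw [hψ (ξ + η), hψ (ξ - η), hψ ξ]

/-- **Sine transform of the weighted lattice measure vanishes** (evenness of `m`). [folklore] -/
theorem levyCT_lattice_sin_transform (m : Site 3 → ℝ) (heven : ∀ y, m (-y) = m y) (α : ℝ)
    (R : ℕ) (ξ : Fin 3 → ℝ) :
    ∑' x : Site 3, (R : ℝ) ^ α * m x * (1 - Real.exp (-(1 / 2 * ∑ i, ((x i : ℝ) / R) ^ 2))) *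
        Real.sin (∑ j, ξ j * ((x j : ℝ) / R)) = 0 := by
  set F : Site 3 → ℝ := fun x => (R : ℝ) ^ α * m x *
    (1 - Real.exp (-(1 / 2 * ∑ i, ((x i : ℝ) / R) ^ 2))) *
      Real.sin (∑ j, ξ j * ((x j : ℝ) / R)) with hF
  have hneg : ∀ x, F (-x) = -F x := by
    intro x
    simp only [hF, Pi.neg_apply, Int.cast_neg, neg_div, mul_neg, Finset.sum_neg_distrib,
      Real.sin_neg, heven, neg_sq]
  have h := (Equiv.neg (Site 3)).tsum_eq F
  simp only [Equiv.neg_apply, hneg, tsum_neg] at h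
  change ∑' x, F x = 0
  linarith

/-! ### Dominated convergence for the Gaussian averages -/

/-- **Dominated convergence for Gaussian averages of symbols.**  If `ψₙ → Ψ` pointwise, all
continuous, with `|ψₙ(k)| ≤ C₂ (1 + |k|₂²)` eventually, then
`∫ γ(η)((ψₙ(ξ+η)+ψₙ(ξ-η))/2 - ψₙ(ξ)) dη → ∫ γ(η)((Ψ(ξ+η)+Ψ(ξ-η))/2 - Ψ(ξ)) dη`
(the Gaussian has a finite second moment). [folklore] -/
theorem levyCT_dominated (ψ : ℕ → (Fin 3 → ℝ) → ℝ) (Ψ : (Fin 3 → ℝ) → ℝ)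
    (hψc : ∀ n, Continuous (ψ n)) (C₂ : ℝ)
    (hbound : ∀ᶠ n in atTop, ∀ k, |ψ n k| ≤ C₂ * (1 + ∑ i, k i ^ 2))
    (hlim : ∀ k, Tendsto (fun n => ψ n k) atTop (𝓝 (Ψ k))) (ξ : Fin 3 → ℝ) :
    Tendsto (fun n => ∫ η : Fin 3 → ℝ,
        Real.exp (-(1 / 2 * ∑ i, η i ^ 2)) / (2 * Real.pi) ^ (3 / 2 : ℝ) *
          ((ψ n (ξ + η) + ψ n (ξ - η)) / 2 - ψ n ξ)) atTop
      (𝓝 (∫ η : Fin 3 → ℝ, Real.exp (-(1 / 2 * ∑ i, η i ^ 2)) / (2 * Real.pi) ^ (3 / 2 : ℝ) *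
          ((Ψ (ξ + η) + Ψ (ξ - η)) / 2 - Ψ ξ))) := by
  set γ : (Fin 3 → ℝ) → ℝ :=
    fun η => Real.exp (-(1 / 2 * ∑ i, η i ^ 2)) / (2 * Real.pi) ^ (3 / 2 : ℝ) with hγ
  have hγ0 : ∀ η, 0 ≤ γ η := fun η => by positivity
  have hγc : Continuous γ := by
    simp only [hγ]
    fun_prop
  have hγi : Integrable (fun η : Fin 3 → ℝ => (1 + ∑ i, η i ^ 2) * γ η) :=
    levyCT_gauss_moment_integrable
  obtain ⟨N, hN⟩ := hbound.exists
  have hC₂ : 0 ≤ C₂ := by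
    have h := hN 0
    simp only [Pi.zero_apply, ne_eq, OfNat.ofNat_ne_zero, not_false_eq_true, zero_pow,
      Finset.sum_const_zero, add_zero, mul_one] at h
    exact (abs_nonneg _).trans h
  have hSξ : 0 ≤ ∑ i, ξ i ^ 2 := Finset.sum_nonneg fun i _ => sq_nonneg _
  refine tendsto_integral_filter_of_dominated_convergence
    (fun η => C₂ * (2 + 3 * ∑ i, ξ i ^ 2) * ((1 + ∑ i, η i ^ 2) * γ η)) ?_ ?_
    (hγi.const_mul _) ?_
  · exact Eventually.of_forall fun n =>
      (hγc.mul (((((hψc n).comp (continuous_const.add continuous_id)).add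
        ((hψc n).comp (continuous_const.sub continuous_id))).div_const 2).sub
          continuous_const)).aestronglyMeasurable
  · filter_upwards [hbound] with n hn
    refine ae_of_all _ fun η => ?_
    have hSη : 0 ≤ ∑ i, η i ^ 2 := Finset.sum_nonneg fun i _ => sq_nonneg _
    have h1 := hn (ξ + η)
    have h2 := hn (ξ - η)
    have h3 := hn ξ
    have hsq1 : ∑ i, (ξ + η) i ^ 2 ≤ 2 * ∑ i, ξ i ^ 2 + 2 * ∑ i, η i ^ 2 := by
      rw [Finset.mul_sum, Finset.mul_sum, ← Finset.sum_add_distrib]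
      exact Finset.sum_le_sum fun i _ => by
        simp only [Pi.add_apply]
        nlinarith [sq_nonneg (ξ i - η i)]
    have hsq2 : ∑ i, (ξ - η) i ^ 2 ≤ 2 * ∑ i, ξ i ^ 2 + 2 * ∑ i, η i ^ 2 := by
      rw [Finset.mul_sum, Finset.mul_sum, ← Finset.sum_add_distrib]
      exact Finset.sum_le_sum fun i _ => by
        simp only [Pi.sub_apply]
        nlinarith [sq_nonneg (ξ i + η i)]
    have e1 : C₂ * (1 + ∑ i, (ξ + η) i ^ 2) ≤ C₂ * (1 + 2 * ∑ i, ξ i ^ 2 + 2 * ∑ i, η i ^ 2) :=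
      mul_le_mul_of_nonneg_left (by linarith) hC₂
    have e2 : C₂ * (1 + ∑ i, (ξ - η) i ^ 2) ≤ C₂ * (1 + 2 * ∑ i, ξ i ^ 2 + 2 * ∑ i, η i ^ 2) :=
      mul_le_mul_of_nonneg_left (by linarith) hC₂
    have e3 : C₂ * (2 + 3 * ∑ i, ξ i ^ 2) * (1 + ∑ i, η i ^ 2) =
        C₂ * (2 + 3 * ∑ i, ξ i ^ 2 + 2 * ∑ i, η i ^ 2) +
          C₂ * (3 * (∑ i, ξ i ^ 2) * ∑ i, η i ^ 2) := by ring
    have e4 : 0 ≤ C₂ * (3 * (∑ i, ξ i ^ 2) * ∑ i, η i ^ 2) := by positivity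
    have habs : |(ψ n (ξ + η) + ψ n (ξ - η)) / 2 - ψ n ξ| ≤
        (|ψ n (ξ + η)| + |ψ n (ξ - η)|) / 2 + |ψ n ξ| := by
      calc |(ψ n (ξ + η) + ψ n (ξ - η)) / 2 - ψ n ξ|
          ≤ |(ψ n (ξ + η) + ψ n (ξ - η)) / 2| + |ψ n ξ| := abs_sub _ _
        _ ≤ (|ψ n (ξ + η)| + |ψ n (ξ - η)|) / 2 + |ψ n ξ| := by
            rw [abs_div, abs_two]
            gcongr
            exact abs_add_le _ _
    rw [Real.norm_eq_abs, abs_mul, abs_of_nonneg (hγ0 η)]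
    calc γ η * |(ψ n (ξ + η) + ψ n (ξ - η)) / 2 - ψ n ξ|
        ≤ γ η * (C₂ * (2 + 3 * ∑ i, ξ i ^ 2) * (1 + ∑ i, η i ^ 2)) := by
          refine mul_le_mul_of_nonneg_left ?_ (hγ0 η)
          linarith
      _ = C₂ * (2 + 3 * ∑ i, ξ i ^ 2) * ((1 + ∑ i, η i ^ 2) * γ η) := by ring
  · exact ae_of_all _ fun η =>
      ((((hlim (ξ + η)).add (hlim (ξ - η))).div_const 2).sub (hlim ξ)).const_mul (γ η)

/-- **Registered helper sub-goal `stub_levyContinuityTransfer_auxLatticeCosTransform`** of stub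
`stub_levyContinuityTransfer` (line `diffusive-branch-is-nonsaturation`, crux
stmt-CriticalPhenomena-4799): the cosine transform of the weighted rescaled lattice measure is the
Gaussian average of the second differences of the symbol. [folklore] -/
theorem stub_levyContinuityTransfer_auxLatticeCosTransform :
    ∀ (m : Site 3 → ℝ), Summable m → ∀ (α : ℝ) (R : ℕ) (ψ : (Fin 3 → ℝ) → ℝ),
      (∀ k, ψ k = (R : ℝ) ^ α * ∑' y : Site 3, m y * (1 - Real.cos (∑ i, k i * ((y i : ℝ) / R)))) →
      ∀ ξ : Fin 3 → ℝ,
        ∑' x : Site 3, (R : ℝ) ^ α * m x * (1 - Real.exp (-(1 / 2 * ∑ i, ((x i : ℝ) / R) ^ 2))) *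
            Real.cos (∑ j, ξ j * ((x j : ℝ) / R)) =
          ∫ η : Fin 3 → ℝ, Real.exp (-(1 / 2 * ∑ i, η i ^ 2)) / (2 * Real.pi) ^ (3 / 2 : ℝ) *
            ((ψ (ξ + η) + ψ (ξ - η)) / 2 - ψ ξ) :=
  fun m hm α R ψ hψ ξ => levyCT_lattice_cos_transform m hm α R ψ hψ ξ

end Summit.CriticalPhenomena.Ising3DConformalLimit.Cruxes.DirectCorrelationStableTail.DiffusiveBranchIsNonsaturation

end
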